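import Literature.Geometry.Lorentzian.KerrSchild
import HarnessLib

/-!
# The timelike vector field `T + (2Mar/(r² + a²)²) Φ` on subextremal Kerr
# (Dafermos–Rodnianski–Shlapentokh-Rothman, Lemma 4.7.1)

(family `gr`, infrastructure for statement **gr.S24**; namespace `Literature.Geometry.Lorentzian.Kerr`)

Dafermos–Rodnianski–Shlapentokh-Rothman (*Decay for solutions of the wave equation on Kerr
exterior spacetimes III*, arXiv:1402.7034 = Ann. of Math. 183 (2016), §4.7, Lemma 4.7.1) prove:
*the vector field `T + (2Mar/(r² + a²)²) Φ` is timelike in `𝓡 ∖ 𝓗⁺` and null on `𝓗⁺`*, where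
`T = ∂_{t*}` and `Φ = ∂_{φ*}` are the stationary and axial Killing fields of the subextremal Kerr
metric `g_{a,M}`, `|a| < M`. In particular the span of `T` and `Φ` is a timelike plane at every
point off the horizon (loc. cit. §2.2.2), although `T` itself is spacelike in the ergoregion. This
lemma is the ingredient of the *a posteriori* energy-boundedness argument of loc. cit. §13
(Prop. 13.1.2: a `φ_τ`-invariant timelike vector field which is Killing on a prescribed radial
shell), i.e. of estimate (23) of their Theorem 3.1, vendored in `BlackHoles.lean` as the named
fact `drsr_wave_boundedness_kerr`.

This file **proves** the lemma for the prelude's Kerr metric in ingoing Kerr–Schild Cartesian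
coordinates (`KerrSchild.lean`: `g = η + 2H ℓ ⊗ ℓ` on `Kerr.region a r₀ = {r > max r₀ 0}`,
`T = Kerr.stationaryField = ∂₀`, `Φ = Kerr.axialField = x₁ ∂₂ − x₂ ∂₁`):

* `Kerr.drsrAngularVelocity M a r = 2Mar/(r² + a²)²`, equal at `r = r₊` to the angular velocity
  of the horizon `Kerr.horizonAngularVelocity M a = a/(2Mr₊)` (`drsrAngularVelocity_rPlus`);
* `Kerr.drsrVector M a x = ∂₀ + ω(r) (x₁ ∂₂ − x₂ ∂₁) ∈ E4` and the section `Kerr.drsrField M a r₀`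
  of `T(Kerr.region a r₀)` it defines (`drsrField_eq`: it is `T + ω(r) Φ`);
* the closed form `g(V, V) = −1 + ω²(x₁² + x₂²) + 2H (1 − aω (x₁² + x₂²)/(r² + a²))²`
  (`bilin_drsrVector`) and its Boyer–Lindquist form `ρ² g(V, V) = −Δ + sin²θ (a² −
  4M²r²a²/(r²+a²)² − 4M²r²a⁴ sin²θ Δ/(r²+a²)⁴)` of the printed proof (`drsr_rho_sq_mul_eq`,
  `sin²θ = (x₁² + x₂²)/(r² + a²) = 1 − x₃²/r²`);
* **Lemma 4.7.1**: `g(V, V) < 0` at every point with `r > r₊` for `|a| < M`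
  (`bilin_drsrVector_neg`, manifold form `isTimelike_drsrField` on `Kerr.exterior M a`), and
  `g(V, V) = 0` at every point with `r = r₊` for `|a| ≤ M`, `0 < M` (`bilin_drsrVector_eq_zero`,
  manifold form `isNull_drsrField` on any `Kerr.region a r₀` containing horizon points);
* the corollary actually consumed in loc. cit. §13.1.4: at every exterior point some constant
  combination `T + c Φ` of the two Killing fields is timelike
  (`exists_isTimelike_stationaryField_add_smul_axialField`).

The proof is the printed one (multiply by `ρ²`, drop the nonpositive last term, use `sin²θ ≤ 1`,
factor `(r²+a²)² (a² − 4M²r²a²/(r²+a²)² − Δ) = Δ (−Δ² − (4Mr − a²) Δ − 4Mr (Mr − a²)) < 0`).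

## Design choices

* Everything is first proved for the bare form `Kerr.bilin M a x`, `x : E4`, under a hypothesis on
  the Kerr–Schild radius `Kerr.radius a x` (no instances), then restated for the bundled metric
  `Kerr.metric M a r₀` under `[Kerr.Facts]` (value `Kerr.bilin M a x` by `rfl`). The horizon
  `{r = r₊}` is not in `Kerr.exterior M a`, so the null statement lives on `Kerr.region a r₀`
  (non-vacuous for `r₀ < r₊`).
* Lemma 4.7.2 of loc. cit. (`T + ω₊ Φ` timelike on a collar of `𝓗⁺`) is not needed for
  Theorem 3.1 (23) and is not formalised. Nothing here is in Mathlib (no Lorentzian geometry).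

## References

* M. Dafermos, I. Rodnianski, Y. Shlapentokh-Rothman, *Decay for solutions of the wave equation
  on Kerr exterior spacetimes III: the full subextremal case `|a| < M`*, Ann. of Math. 183 (2016)
  787–913, arXiv:1402.7034: §2.2.2 (Killing fields, `K = T + ω₊Φ`, `ω₊ = a/(2Mr₊)`), §4.7
  Lemma 4.7.1, §13.1.4 Prop. 13.1.2 (key `DafermosRodnianskiShlapentokhrothman2014`).
* B. O'Neill, *The geometry of Kerr black holes*, A K Peters 1995, Ch. 2, §2.4–2.5 (key
  `ONeill1995`).
-/

noncomputable section

open scoped Manifold ContDiff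

namespace Literature.Geometry.Lorentzian

namespace Kerr

/-! ### The angular velocities `ω(r) = 2Mar/(r² + a²)²` and `ω₊ = a/(2Mr₊)` -/

/-- The **angular-velocity profile** `ω(r) = 2Mar / (r² + a²)²` of the vector field
`T + ω(r) Φ` of Dafermos–Rodnianski–Shlapentokh-Rothman, arXiv:1402.7034, Lemma 4.7.1.
[cite: DafermosRodnianskiShlapentokhrothman2014, Lemma 4.7.1] -/
def drsrAngularVelocity (M a r : ℝ) : ℝ := 2 * M * a * r / (r ^ 2 + a ^ 2) ^ 2

/-- The **angular velocity of the event horizon** `ω₊ = a / (2 M r₊)`: the Killing field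
`K = T + ω₊ Φ` is the null generator of `𝓗⁺`. DRSR arXiv:1402.7034, §2.2.2; O'Neill 1995, Ch. 2,
§2.5. [cite: DafermosRodnianskiShlapentokhrothman2014, §2.2.2] -/
def horizonAngularVelocity (M a : ℝ) : ℝ := a / (2 * M * rPlus M a)

/-- `r₊² + a² = 2M r₊` whenever `|a| ≤ M` (i.e. `Δ(r₊) = 0`, `r₊ = M + √(M² − a²)`); this covers
the extremal case. DRSR arXiv:1402.7034, §2.1.2. [cite: DafermosRodnianskiShlapentokhrothman2014, §2.1.2] -/
theorem rPlus_sq_add_sq {M a : ℝ} (h : |a| ≤ M) : rPlus M a ^ 2 + a ^ 2 = 2 * M * rPlus M a := by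
  have ha : a ^ 2 ≤ M ^ 2 := by
    have h0 : 0 ≤ |a| := abs_nonneg a
    nlinarith [sq_abs a, abs_nonneg a]
  have hs : √(M ^ 2 - a ^ 2) ^ 2 = M ^ 2 - a ^ 2 := Real.sq_sqrt (sub_nonneg.2 ha)
  unfold rPlus
  nlinarith [hs]

/-- `ω(r₊) = ω₊`: on the horizon the DRSR profile is the horizon angular velocity
(`(r₊² + a²)² = (2Mr₊)²`). Needs `|a| ≤ M` and `0 < M` (so that `r₊ > 0`). DRSR arXiv:1402.7034,
proof of Lemma 4.7.1. [cite: DafermosRodnianskiShlapentokhrothman2014, Lemma 4.7.1] -/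
theorem drsrAngularVelocity_rPlus {M a : ℝ} (h : |a| ≤ M) (hM : 0 < M) :
    drsrAngularVelocity M a (rPlus M a) = horizonAngularVelocity M a := by
  have hr : 0 < rPlus M a := by
    unfold rPlus
    linarith [Real.sqrt_nonneg (M ^ 2 - a ^ 2)]
  rw [drsrAngularVelocity, horizonAngularVelocity, rPlus_sq_add_sq h]
  have h2 : (2 * M * rPlus M a) ≠ 0 := by positivity
  field_simp

/-! ### The vector `V = ∂₀ + ω(r) (x₁ ∂₂ − x₂ ∂₁)` in Kerr–Schild coordinates -/

/-- The **axial vector** `∂_{φ*} = x₁ ∂₂ − x₂ ∂₁ ∈ E4` at the point `x` (the value of the Killing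
field `Kerr.axialField`, rotations about the `x₃`-axis). DRSR arXiv:1402.7034, §2.1.1–§2.2.2;
O'Neill 1995, Ch. 2, §2.2. [cite: DafermosRodnianskiShlapentokhrothman2014, §2.2.2] -/
def axialVector (x : E4) : E4 := (x 1) • E4.basisVector 2 - (x 2) • E4.basisVector 1

/-- The **DRSR vector** `V = T + ω(r) Φ = ∂₀ + (2Mar/(r² + a²)²) (x₁ ∂₂ − x₂ ∂₁)` at `x`, with
`r = Kerr.radius a x` the Kerr–Schild radius. DRSR arXiv:1402.7034, Lemma 4.7.1.
[cite: DafermosRodnianskiShlapentokhrothman2014, Lemma 4.7.1] -/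
def drsrVector (M a : ℝ) (x : E4) : E4 :=
  E4.basisVector 0 + drsrAngularVelocity M a (radius a x) • axialVector x

/-- The DRSR vector field `x ↦ T + ω(r) Φ` as a section of `T(Kerr.region a r₀)` (the tangent
spaces of the open chart domain are `E4` definitionally). DRSR arXiv:1402.7034, Lemma 4.7.1.
[cite: DafermosRodnianskiShlapentokhrothman2014, Lemma 4.7.1] -/
def drsrField (M a r₀ : ℝ) : Π x : region a r₀, TangentSpace 𝓘(ℝ, E4) x :=
  fun x ↦ drsrVector M a x.1

/-- `drsrField = T + ω(r) Φ` in terms of the Killing fields `Kerr.stationaryField = ∂₀` and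
`Kerr.axialField = x₁ ∂₂ − x₂ ∂₁` of `KerrSchild.lean` (by `rfl`). DRSR arXiv:1402.7034,
Lemma 4.7.1. [cite: DafermosRodnianskiShlapentokhrothman2014, Lemma 4.7.1] -/
theorem drsrField_eq (M a r₀ : ℝ) (x : region a r₀) :
    drsrField M a r₀ x =
      stationaryField a r₀ x + drsrAngularVelocity M a (radius a x.1) • axialField a r₀ x :=
  rfl

/-- The time component of the axial vector vanishes: `(x₁ ∂₂ − x₂ ∂₁)⁰ = 0`. [folklore] -/
@[simp]
theorem axialVector_apply_zero (x : E4) : axialVector x 0 = 0 := by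
  simp [axialVector]

/-- The time component of the DRSR vector is `1` (so `V ≠ 0`). [folklore] -/
@[simp]
theorem drsrVector_apply_zero (M a : ℝ) (x : E4) : drsrVector M a x 0 = 1 := by
  simp [drsrVector]

/-- The DRSR vector is non-zero (its time component is `1`). [folklore] -/
theorem drsrVector_ne_zero (M a : ℝ) (x : E4) : drsrVector M a x ≠ 0 := by
  intro h
  have := drsrVector_apply_zero M a x
  rw [h] at this
  simp at this

/-- `ℓ(x₁ ∂₂ − x₂ ∂₁) = −a (x₁² + x₂²)/(r² + a²)` for the Kerr–Schild null covector
`ℓ = (1, (r x₁ + a x₂)/(r² + a²), (r x₂ − a x₁)/(r² + a²), x₃/r)` (the `r`-terms cancel).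
Kerr–Schild 1965; Visser arXiv:0706.0622, (34). [folklore] -/
theorem nullCovector_axialVector (a : ℝ) (x : E4) :
    nullCovector a x (axialVector x) = -(a * (x 1 ^ 2 + x 2 ^ 2) / (radius a x ^ 2 + a ^ 2)) := by
  simp [nullCovector, nullCovectorFun, Fin.sum_univ_four, axialVector]
  ring

/-- `η(x₁ ∂₂ − x₂ ∂₁, x₁ ∂₂ − x₂ ∂₁) = x₁² + x₂²`. [folklore] -/
theorem minkowski_axialVector (x : E4) :
    Minkowski.bilin (axialVector x) (axialVector x) = x 1 ^ 2 + x 2 ^ 2 := by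
  simp [Fin.sum_univ_three, axialVector]
  ring

/-- `η(∂₀, x₁ ∂₂ − x₂ ∂₁) = 0`. [folklore] -/
theorem minkowski_basisVector_zero_axialVector (x : E4) :
    Minkowski.bilin (E4.basisVector 0) (axialVector x) = 0 := by
  rw [Minkowski.bilin_basisVector_zero_left, axialVector_apply_zero, neg_zero]

/-- `ℓ(V) = 1 − ω(r) a (x₁² + x₂²)/(r² + a²)` (using `ℓ₀ = 1`). DRSR arXiv:1402.7034, proof of
Lemma 4.7.1 (Kerr–Schild form). [folklore] -/
theorem nullCovector_drsrVector (M a : ℝ) (x : E4) :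
    nullCovector a x (drsrVector M a x) =
      1 - drsrAngularVelocity M a (radius a x) * (a * (x 1 ^ 2 + x 2 ^ 2) /
        (radius a x ^ 2 + a ^ 2)) := by
  rw [drsrVector, map_add, map_smul, nullCovector_basisVector_zero, nullCovector_axialVector,
    smul_eq_mul]
  ring

/-- `η(V, V) = −1 + ω(r)² (x₁² + x₂²)`. DRSR arXiv:1402.7034, proof of Lemma 4.7.1
(Kerr–Schild form). [folklore] -/
theorem minkowski_drsrVector (M a : ℝ) (x : E4) :
    Minkowski.bilin (drsrVector M a x) (drsrVector M a x) =
      -1 + drsrAngularVelocity M a (radius a x) ^ 2 * (x 1 ^ 2 + x 2 ^ 2) := by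
  have h1 := minkowski_basisVector_zero_axialVector x
  have h2 : Minkowski.bilin (axialVector x) (E4.basisVector 0) = 0 := by
    rw [Minkowski.bilin_symm, h1]
  simp only [drsrVector, map_add, map_smul, _root_.add_apply,
    FunLike.coe_smul, Pi.smul_apply, smul_eq_mul, h1, h2,
    Minkowski.bilin_basisVector_zero, minkowski_axialVector]
  ring

/-- **Closed form of `g(V, V)` in Kerr–Schild coordinates**:
`g(V, V) = −1 + ω²(x₁² + x₂²) + 2H (1 − aω (x₁² + x₂²)/(r² + a²))²` for
`V = T + ω(r) Φ`, `g = η + 2H ℓ ⊗ ℓ`. With `x₁² + x₂² = (r² + a²) sin²θ`, `H = Mr/ρ²` this is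
`ρ⁻² (−Δ + sin²θ (a² − 4M²r²a²/(r²+a²)² − 4M²r²a⁴ sin²θ Δ/(r²+a²)⁴))`, the Boyer–Lindquist
expression of DRSR arXiv:1402.7034, proof of Lemma 4.7.1. [cite: DafermosRodnianskiShlapentokhrothman2014, Lemma 4.7.1 (proof)] -/
theorem bilin_drsrVector (M a : ℝ) (x : E4) :
    bilin M a x (drsrVector M a x) (drsrVector M a x) =
      -1 + drsrAngularVelocity M a (radius a x) ^ 2 * (x 1 ^ 2 + x 2 ^ 2) +
        2 * scalarH M a x * (1 - drsrAngularVelocity M a (radius a x) *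
          (a * (x 1 ^ 2 + x 2 ^ 2) / (radius a x ^ 2 + a ^ 2))) ^ 2 := by
  rw [bilin_apply, minkowski_drsrVector, nullCovector_drsrVector]
  ring

/-! ### Kerr–Schild trigonometry: `sin²θ = (x₁² + x₂²)/(r² + a²) = 1 − x₃²/r²` -/

/-- `x₁² + x₂² = (r² + a²)(r² − x₃²)/r²` wherever `r > 0`: the defining quartic
`r⁴ − (‖x⃗‖² − a²) r² − a² x₃² = 0` of the Kerr–Schild radius, rearranged (the confocal
ellipsoids `(x₁² + x₂²)/(r² + a²) + x₃²/r² = 1`). Visser arXiv:0706.0622, (35). [folklore] -/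
theorem sq_add_sq_eq (a : ℝ) {x : E4} (hx : 0 < radius a x) :
    x 1 ^ 2 + x 2 ^ 2 =
      (radius a x ^ 2 + a ^ 2) * (radius a x ^ 2 - x 3 ^ 2) / radius a x ^ 2 := by
  have hq := radius_quartic a x
  rw [E4.spatialNorm_sq] at hq
  have hr : radius a x ^ 2 ≠ 0 := by positivity
  field_simp
  linear_combination (-1 : ℝ) * hq

/-- `x₃² ≤ r²` wherever `r > 0` (i.e. `cos²θ = x₃²/r² ≤ 1`). Visser arXiv:0706.0622, (35).
[folklore] -/
theorem sq_apply_three_le_radius_sq (a : ℝ) {x : E4} (hx : 0 < radius a x) :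
    x 3 ^ 2 ≤ radius a x ^ 2 := by
  have h := sq_add_sq_eq a hx
  have hA : 0 < radius a x ^ 2 + a ^ 2 := by positivity
  have hr2 : 0 < radius a x ^ 2 := by positivity
  by_contra hlt
  push Not at hlt
  have : (radius a x ^ 2 + a ^ 2) * (radius a x ^ 2 - x 3 ^ 2) / radius a x ^ 2 < 0 :=
    div_neg_of_neg_of_pos (mul_neg_of_pos_of_neg hA (by linarith)) hr2
  nlinarith [sq_nonneg (x 1), sq_nonneg (x 2)]

/-- `2H = 2Mr/ρ²` with `ρ² = r² + a² cos²θ = r² + a² x₃²/r²`, i.e.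
`scalarH M a x = M r / (r² + a² (1 − σ))` for `σ = sin²θ = (r² − x₃²)/r²`, wherever `r > 0`
(`H = Mr³/(r⁴ + a²x₃²)`). Visser arXiv:0706.0622, (33). [folklore] -/
theorem scalarH_eq_div (M a : ℝ) {x : E4} (hx : 0 < radius a x) :
    scalarH M a x =
      M * radius a x / (radius a x ^ 2 + a ^ 2 * (1 - (radius a x ^ 2 - x 3 ^ 2) / radius a x ^ 2)) := by
  have hr : radius a x ≠ 0 := hx.ne'
  have h1 : radius a x ^ 2 + a ^ 2 * (1 - (radius a x ^ 2 - x 3 ^ 2) / radius a x ^ 2) =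
      (radius a x ^ 4 + a ^ 2 * x 3 ^ 2) / radius a x ^ 2 := by
    field_simp
    ring
  rw [h1, scalarH, div_div_eq_mul_div]
  ring

/-! ### Lemma 4.7.1: the algebra -/

/-- **The Boyer–Lindquist form of `ρ² g(V, V)`** (the identity behind the printed proof): for
any reals with `r² + a² ≠ 0` and `ρ² = r² + a²(1 − σ) ≠ 0`,
`ρ² (−1 + ω² σ (r² + a²) + (2Mr/ρ²)(1 − ωaσ)²) = −Δ + σ (a² − 4M²r²a²/(r²+a²)² − 4M²r²a⁴σΔ/(r²+a²)⁴)`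
with `ω = 2Mar/(r² + a²)²`, `Δ = r² − 2Mr + a²`, `σ = sin²θ`. DRSR arXiv:1402.7034, proof of
Lemma 4.7.1 (first display). [cite: DafermosRodnianskiShlapentokhrothman2014, Lemma 4.7.1 (proof)] -/
theorem drsr_rho_sq_mul_eq {M a r σ : ℝ} (hA : r ^ 2 + a ^ 2 ≠ 0)
    (hD : r ^ 2 + a ^ 2 * (1 - σ) ≠ 0) :
    (r ^ 2 + a ^ 2 * (1 - σ)) * (-1 + drsrAngularVelocity M a r ^ 2 * (σ * (r ^ 2 + a ^ 2)) +
        2 * M * r / (r ^ 2 + a ^ 2 * (1 - σ)) * (1 - drsrAngularVelocity M a r * (a * σ)) ^ 2) =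
      -(r ^ 2 - 2 * M * r + a ^ 2) + σ * ((a ^ 2 - 4 * M ^ 2 * r ^ 2 * a ^ 2 / (r ^ 2 + a ^ 2) ^ 2)
        - 4 * M ^ 2 * r ^ 2 * a ^ 4 * σ * (r ^ 2 - 2 * M * r + a ^ 2) / (r ^ 2 + a ^ 2) ^ 4) := by
  unfold drsrAngularVelocity
  field_simp
  ring


/-- **The algebraic heart of DRSR Lemma 4.7.1.** For `|a| < M`, `r > r₊` and `0 ≤ σ ≤ 1`
(`σ = sin²θ`), `−1 + ω(r)² σ (r² + a²) + (2Mr/(r² + a²(1 − σ))) (1 − ω(r) a σ)² < 0`.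
Proof as printed (arXiv:1402.7034, Lemma 4.7.1): times `ρ² = r² + a²(1 − σ)` the left side is
`−Δ + σ (a² − 4M²r²a²/(r²+a²)² − 4M²r²a⁴σΔ/(r²+a²)⁴)`; the last term is `≤ 0`, `σ ≤ 1`, and
`(r²+a²)² (a² − 4M²r²a²/(r²+a²)² − Δ) = Δ(−Δ² − (4Mr − a²)Δ − 4Mr(Mr − a²)) < 0` by `r > M > |a|`.
[cite: DafermosRodnianskiShlapentokhrothman2014, Lemma 4.7.1] -/
theorem drsr_timelike_aux {M a r σ : ℝ} (hMa : |a| < M) (hr : rPlus M a < r) (hσ0 : 0 ≤ σ)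
    (hσ1 : σ ≤ 1) :
    -1 + drsrAngularVelocity M a r ^ 2 * (σ * (r ^ 2 + a ^ 2)) +
        2 * M * r / (r ^ 2 + a ^ 2 * (1 - σ)) * (1 - drsrAngularVelocity M a r * (a * σ)) ^ 2
      < 0 := by
  have hM : 0 < M := (abs_nonneg a).trans_lt hMa
  have ha2 : a ^ 2 < M ^ 2 := by nlinarith [abs_nonneg a, sq_abs a, abs_lt.1 hMa]
  have h1 : √(M ^ 2 - a ^ 2) < r - M := by unfold rPlus at hr; linarith
  have hrM : M < r := by linarith [Real.sqrt_nonneg (M ^ 2 - a ^ 2)]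
  have hr0 : 0 < r := hM.trans hrM
  set Δ : ℝ := r ^ 2 - 2 * M * r + a ^ 2 with hΔ_def
  have hΔ : 0 < Δ := by
    have hs2 : √(M ^ 2 - a ^ 2) ^ 2 = M ^ 2 - a ^ 2 := Real.sq_sqrt (by linarith)
    have h2 : M ^ 2 - a ^ 2 < (r - M) ^ 2 := by nlinarith [Real.sqrt_nonneg (M ^ 2 - a ^ 2)]
    rw [hΔ_def]; nlinarith
  set A : ℝ := r ^ 2 + a ^ 2 with hA_def
  have hA : 0 < A := by positivity
  have hD : 0 < r ^ 2 + a ^ 2 * (1 - σ) := by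
    have : 0 ≤ a ^ 2 * (1 - σ) := mul_nonneg (sq_nonneg a) (by linarith)
    positivity
  -- `ρ² ×` the quantity, in the Boyer–Lindquist form of the printed proof; bound its pieces
  set P : ℝ := a ^ 2 - 4 * M ^ 2 * r ^ 2 * a ^ 2 / A ^ 2 with hP_def
  have hlast : 0 ≤ 4 * M ^ 2 * r ^ 2 * a ^ 4 * σ * Δ / A ^ 4 := by positivity
  have h4Mr : 0 < 4 * M * r - a ^ 2 := by nlinarith
  have hMr : 0 < M * r - a ^ 2 := by nlinarith
  have hPΔ : P - Δ < 0 := by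
    have hcub : A ^ 2 * (P - Δ) =
        Δ * (-Δ ^ 2 - (4 * M * r - a ^ 2) * Δ - 4 * M * r * (M * r - a ^ 2)) := by
      rw [hP_def]
      field_simp
      rw [show A = Δ + 2 * M * r by rw [hA_def, hΔ_def]; ring]
      ring
    have hneg : A ^ 2 * (P - Δ) < 0 := hcub ▸ mul_neg_of_pos_of_neg hΔ (by
      nlinarith [mul_pos hΔ h4Mr, mul_pos (by positivity : (0:ℝ) < 4 * M * r) hMr])
    exact neg_of_mul_neg_right hneg (by positivity)
  have hrhs : -Δ + σ * (P - 4 * M ^ 2 * r ^ 2 * a ^ 4 * σ * Δ / A ^ 4) < 0 := by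
    rcases le_or_gt P 0 with hP | hP
    · nlinarith [mul_nonpos_of_nonneg_of_nonpos hσ0 (show P - 4 * M ^ 2 * r ^ 2 * a ^ 4 * σ * Δ /
        A ^ 4 ≤ 0 by linarith)]
    · nlinarith [mul_le_mul_of_nonneg_left (show P - 4 * M ^ 2 * r ^ 2 * a ^ 4 * σ * Δ / A ^ 4
        ≤ P by linarith) hσ0]
  -- divide by `ρ² > 0`
  refine neg_of_mul_neg_right ?_ hD.le
  rw [drsr_rho_sq_mul_eq hA.ne' hD.ne']
  exact hrhs

/-- **The algebra of the null case.** For `|a| ≤ M`, `0 < M`, `r = r₊` and any `σ` with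
`r₊² + a²(1 − σ) ≠ 0`: `−1 + ω(r₊)² σ (r₊² + a²) + (2Mr₊/(r₊² + a²(1 − σ))) (1 − ω(r₊) a σ)² = 0`
(`Δ(r₊) = 0` and `4M²r₊²a²/(r₊² + a²)² = a²`). DRSR arXiv:1402.7034, Lemma 4.7.1 (null on `𝓗⁺`).
[cite: DafermosRodnianskiShlapentokhrothman2014, Lemma 4.7.1] -/
theorem drsr_null_aux {M a σ : ℝ} (hMa : |a| ≤ M) (hM : 0 < M)
    (hD : rPlus M a ^ 2 + a ^ 2 * (1 - σ) ≠ 0) :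
    -1 + drsrAngularVelocity M a (rPlus M a) ^ 2 * (σ * (rPlus M a ^ 2 + a ^ 2)) +
        2 * M * rPlus M a / (rPlus M a ^ 2 + a ^ 2 * (1 - σ)) *
          (1 - drsrAngularVelocity M a (rPlus M a) * (a * σ)) ^ 2 = 0 := by
  have hr : 0 < rPlus M a := by
    unfold rPlus
    linarith [Real.sqrt_nonneg (M ^ 2 - a ^ 2)]
  have hA := rPlus_sq_add_sq hMa
  set r := rPlus M a with hr_def
  have hA0 : r ^ 2 + a ^ 2 ≠ 0 := by positivity
  have key := drsr_rho_sq_mul_eq (M := M) (σ := σ) hA0 hD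
  have hΔ : r ^ 2 - 2 * M * r + a ^ 2 = 0 := by linarith
  have hP : a ^ 2 - 4 * M ^ 2 * r ^ 2 * a ^ 2 / (r ^ 2 + a ^ 2) ^ 2 = 0 := by
    rw [hA]
    have h2 : 2 * M * r ≠ 0 := by positivity
    field_simp
    ring
  rw [hΔ, hP] at key
  have h0 : (r ^ 2 + a ^ 2 * (1 - σ)) *
      (-1 + drsrAngularVelocity M a r ^ 2 * (σ * (r ^ 2 + a ^ 2)) +
        2 * M * r / (r ^ 2 + a ^ 2 * (1 - σ)) * (1 - drsrAngularVelocity M a r * (a * σ)) ^ 2) =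
      0 := by
    rw [key]; ring
  exact (mul_eq_zero.1 h0).resolve_left hD

/-! ### Lemma 4.7.1 for the Kerr–Schild form `Kerr.bilin` -/

/-- `g(V, V)` in the variables `(r, σ)`, `σ = sin²θ = (r² − x₃²)/r² ∈ [0, 1]`, wherever `r > 0`:
the closed form `bilin_drsrVector` rewritten with `x₁² + x₂² = σ (r² + a²)` and `2H = 2Mr/ρ²`.
DRSR arXiv:1402.7034, proof of Lemma 4.7.1. [folklore] -/
theorem bilin_drsrVector_eq_of_radius_pos (M a : ℝ) {x : E4} (hr : 0 < radius a x) :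
    bilin M a x (drsrVector M a x) (drsrVector M a x) =
      -1 + drsrAngularVelocity M a (radius a x) ^ 2 *
          ((radius a x ^ 2 - x 3 ^ 2) / radius a x ^ 2 * (radius a x ^ 2 + a ^ 2)) +
        2 * M * radius a x / (radius a x ^ 2 + a ^ 2 * (1 - (radius a x ^ 2 - x 3 ^ 2) /
          radius a x ^ 2)) * (1 - drsrAngularVelocity M a (radius a x) *
            (a * ((radius a x ^ 2 - x 3 ^ 2) / radius a x ^ 2))) ^ 2 := by
  set r := radius a x with hr_def
  have h12 : x 1 ^ 2 + x 2 ^ 2 = (r ^ 2 - x 3 ^ 2) / r ^ 2 * (r ^ 2 + a ^ 2) := by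
    rw [sq_add_sq_eq a hr]
    ring
  have hq : a * (x 1 ^ 2 + x 2 ^ 2) / (r ^ 2 + a ^ 2) = a * ((r ^ 2 - x 3 ^ 2) / r ^ 2) := by
    rw [h12]
    have : r ^ 2 + a ^ 2 ≠ 0 := by positivity
    field_simp
  rw [bilin_drsrVector, ← hr_def, hq, h12, scalarH_eq_div M a hr, ← hr_def]
  ring

/-- `0 ≤ σ ≤ 1` for `σ = (r² − x₃²)/r²`, wherever `r > 0`. [folklore] -/
theorem sinSq_nonneg_and_le_one (a : ℝ) {x : E4} (hr : 0 < radius a x) :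
    0 ≤ (radius a x ^ 2 - x 3 ^ 2) / radius a x ^ 2 ∧
      (radius a x ^ 2 - x 3 ^ 2) / radius a x ^ 2 ≤ 1 := by
  have hr2 : 0 < radius a x ^ 2 := by positivity
  exact ⟨div_nonneg (sub_nonneg.2 (sq_apply_three_le_radius_sq a hr)) hr2.le,
    (div_le_one hr2).2 (by linarith [sq_nonneg (x 3)])⟩

/-- **DRSR Lemma 4.7.1, timelike part, coordinate form.** For subextremal `(M, a)` and every
point `x` of the Kerr–Schild chart with `r(x) > r₊`, `g_{M,a}(x)(V, V) < 0` for
`V = T + (2Mar/(r² + a²)²) Φ`. Dafermos–Rodnianski–Shlapentokh-Rothman, arXiv:1402.7034,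
Lemma 4.7.1 ("timelike in `𝓡 ∖ 𝓗⁺`"). [cite: DafermosRodnianskiShlapentokhrothman2014, Lemma 4.7.1] -/
theorem bilin_drsrVector_neg {M a : ℝ} (hMa : IsSubextremal M a) {x : E4}
    (hx : rPlus M a < radius a x) :
    bilin M a x (drsrVector M a x) (drsrVector M a x) < 0 := by
  have hrp : 0 < rPlus M a := by
    unfold rPlus; linarith [Real.sqrt_nonneg (M ^ 2 - a ^ 2), hMa.pos]
  have hr : 0 < radius a x := hrp.trans hx
  rw [bilin_drsrVector_eq_of_radius_pos M a hr]
  exact drsr_timelike_aux hMa hx (sinSq_nonneg_and_le_one a hr).1 (sinSq_nonneg_and_le_one a hr).2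

/-- **DRSR Lemma 4.7.1, null part, coordinate form.** For `|a| ≤ M`, `0 < M` and every point `x`
of the Kerr–Schild chart on the horizon, `r(x) = r₊`: `g_{M,a}(x)(V, V) = 0` for
`V = T + (2Mar/(r² + a²)²) Φ = T + ω₊ Φ` there. Dafermos–Rodnianski–Shlapentokh-Rothman,
arXiv:1402.7034, Lemma 4.7.1 ("null on `𝓗⁺`"). [cite: DafermosRodnianskiShlapentokhrothman2014, Lemma 4.7.1] -/
theorem bilin_drsrVector_eq_zero {M a : ℝ} (hMa : |a| ≤ M) (hM : 0 < M) {x : E4}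
    (hx : radius a x = rPlus M a) :
    bilin M a x (drsrVector M a x) (drsrVector M a x) = 0 := by
  have hrp : 0 < rPlus M a := by
    unfold rPlus; linarith [Real.sqrt_nonneg (M ^ 2 - a ^ 2)]
  have hr : 0 < radius a x := hx ▸ hrp
  have hD : radius a x ^ 2 + a ^ 2 * (1 - (radius a x ^ 2 - x 3 ^ 2) / radius a x ^ 2) ≠ 0 := by
    have : 0 ≤ a ^ 2 * (1 - (radius a x ^ 2 - x 3 ^ 2) / radius a x ^ 2) :=
      mul_nonneg (sq_nonneg a) (by linarith [(sinSq_nonneg_and_le_one a hr).2])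
    positivity
  rw [bilin_drsrVector_eq_of_radius_pos M a hr]
  rw [hx] at hD ⊢
  exact drsr_null_aux hMa hM hD

/-! ### Lemma 4.7.1 for the bundled Kerr metric -/

/-- **DRSR Lemma 4.7.1 (timelike part).** On the subextremal Kerr exterior
`Kerr.exterior M a = {r > r₊}`, `|a| < M`, the vector field `T + (2Mar/(r² + a²)²) Φ`
(`Kerr.drsrField`) is timelike for the Kerr metric `Kerr.metric M a r₊`. Dafermos–Rodnianski–
Shlapentokh-Rothman, arXiv:1402.7034 = Ann. of Math. 183 (2016), Lemma 4.7.1. The instance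
hypothesis `[Kerr.Facts]` only supplies the bundled metric (its value at `x` is `Kerr.bilin M a x`).
[cite: DafermosRodnianskiShlapentokhrothman2014, Lemma 4.7.1] -/
theorem isTimelike_drsrField [Facts] {M a : ℝ} (hMa : IsSubextremal M a) (x : exterior M a) :
    (metric M a (rPlus M a)).IsTimelike (drsrField M a (rPlus M a) x) := by
  rw [LorentzianMetric.isTimelike_iff, metric_val]
  exact bilin_drsrVector_neg hMa (lt_radius_of_mem_region x.2)

/-- **DRSR Lemma 4.7.1 (null part).** At every point of a Kerr–Schild chart domain
`Kerr.region a r₀` lying on the event horizon `{r = r₊}` (non-vacuous for `r₀ < r₊`), the vector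
`T + (2Mar/(r² + a²)²) Φ = T + ω₊ Φ` is null for `Kerr.metric M a r₀`, for `|a| ≤ M`, `0 < M`.
Dafermos–Rodnianski–Shlapentokh-Rothman, arXiv:1402.7034, Lemma 4.7.1; cf. §2.2.2 (`K = T + ω₊Φ`
is the null generator of `𝓗⁺`). [cite: DafermosRodnianskiShlapentokhrothman2014, Lemma 4.7.1] -/
theorem isNull_drsrField [Facts] {M a : ℝ} (hMa : |a| ≤ M) (hM : 0 < M) {r₀ : ℝ}
    (x : region a r₀) (hx : radius a x.1 = rPlus M a) :
    (metric M a r₀).IsNull (drsrField M a r₀ x) := by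
  refine ⟨?_, drsrVector_ne_zero M a x.1⟩
  rw [metric_val]
  exact bilin_drsrVector_eq_zero hMa hM hx

/-- **The span of `T` and `Φ` is timelike off the horizon** (the form of Lemma 4.7.1 consumed in
DRSR arXiv:1402.7034, §13.1.4, Prop. 13.1.2, and stated in §2.2.2): at every point of the
subextremal Kerr exterior some constant-coefficient combination `T + c Φ` of the two Killing
fields is timelike — namely `c = 2Mar/(r² + a²)²` evaluated at that point. [cite: DafermosRodnianskiShlapentokhrothman2014, §2.2.2 and Lemma 4.7.1] -/
theorem exists_isTimelike_stationaryField_add_smul_axialField [Facts] {M a : ℝ}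
    (hMa : IsSubextremal M a) (x : exterior M a) :
    ∃ c : ℝ, (metric M a (rPlus M a)).IsTimelike
      (stationaryField a (rPlus M a) x + c • axialField a (rPlus M a) x) :=
  ⟨drsrAngularVelocity M a (radius a x.1), (drsrField_eq M a _ x) ▸ isTimelike_drsrField hMa x⟩

end Kerr

end Literature.Geometry.Lorentzian

end
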